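import Summits.ResolutionOfSingularities.ResolutionOfSingularities.Theorems.DeltaCutStellarWOR

/-!
# StellarCut T7 — the carve of `E1TopSHeavy` with `WORNC` DISCHARGED (0-weight glue)

`DeltaCutStellarCells` (T2) carved the S-heavy residual as
`E1NC → E1NCHyp → E1NCEntryPerpetual → E1TopSFrozenOffNC → E1TopSHeavy` (and the edges to `E1TopGHeavy`, `E1TopNoAbs`, `E 1`);
`DeltaCutStellarWOR` (T6) PROVED `worNC_holds : 1 ≤ n → WORNC n`.  This file records the carve with the proved law removed:
`e1NC_holds : E1NC` and `E1NCHyp → E1NCEntryPerpetual → E1TopSFrozenOffNC → E1TopSHeavy / E1TopGHeavy / E1TopNoAbs / E 1`,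
plus the per-level `worTopSHeavyNC_of_hyp : 1 ≤ n → WORNCHyp n → WORTopSHeavyNC n`.  Pure composition; 0 sorry; axioms standard.
-/

noncomputable section

open CategoryTheory CategoryTheory.Limits AlgebraicGeometry TopologicalSpace IsLocalRing
open Literature.AlgebraicGeometry.Resolution

namespace Summit.ResolutionOfSingularities.ResolutionOfSingularities.Theorems.DeltaCutClasses

open Summit.ResolutionOfSingularities.ResolutionOfSingularities.Theorems
open WeakOrderReduction ForcedTowerClasses

section Carve

open SubfieldContactClasses

/-- the family `E1NC = ∀ n ≥ 1, WORNC n` HOLDS. [new] -/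
theorem e1NC_holds : E1NC := fun n hn => worNC_holds n hn

/-- per level: the n.c.-regime part `WORTopSHeavyNC n` of the residual reduces to `WORNCHyp n` alone. [new] -/
theorem worTopSHeavyNC_of_hyp {n : ℕ} (hn : 1 ≤ n) (hH : WORNCHyp n) : WORTopSHeavyNC n :=
  worTopSHeavyNC_of_laws (worNC_holds n hn) hH

/-- **THE CARVE AFTER `WORNC`**: `E1NCHyp → E1NCEntryPerpetual → E1TopSFrozenOffNC → E1TopSHeavy`. [new] -/
theorem e1TopSHeavy_of_ncHyp (hH : E1NCHyp) (hE : E1NCEntryPerpetual) (hO : E1TopSFrozenOffNC) : E1TopSHeavy :=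
  e1TopSHeavy_of_nc e1NC_holds hH hE hO

/-- exact remainder form: `E1NCHyp → E1TopSHeavyOffNC → E1TopSHeavy`. [new] -/
theorem e1TopSHeavy_of_ncHyp_offNC (hH : E1NCHyp) (hO : E1TopSHeavyOffNC) : E1TopSHeavy :=
  e1TopSHeavy_of_nc_offNC e1NC_holds hH hO

/-- edge to the live aside (item 27045): under `E 5`, `E1NCHyp → E1NCEntryPerpetual → E1TopSFrozenOffNC → E1TopGHeavy`. [new] -/
theorem e1TopGHeavy_of_ncHyp (h5 : E 5) (hH : E1NCHyp) (hE : E1NCEntryPerpetual) (hO : E1TopSFrozenOffNC) :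
    E1TopGHeavy :=
  e1TopGHeavy_of_nc h5 e1NC_holds hH hE hO

/-- edge to the column item (26971): under `SubfieldContactAbs` and `E 5`,
`E1NCHyp → E1NCEntryPerpetual → E1TopSFrozenOffNC → E1TopNoAbs`. [new] -/
theorem e1TopNoAbs_of_ncHyp (hSC : SubfieldContactAbs) (h5 : E 5) (hH : E1NCHyp) (hE : E1NCEntryPerpetual)
    (hO : E1TopSFrozenOffNC) : E1TopNoAbs :=
  e1TopNoAbs_of_nc hSC h5 e1NC_holds hH hE hO

/-- summit edge of the column: under `SubfieldContactAbs` and `E 5`,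
`E1NCHyp → E1NCEntryPerpetual → E1TopSFrozenOffNC → E 1`. [new] -/
theorem e_one_of_ncHyp (hSC : SubfieldContactAbs) (h5 : E 5) (hH : E1NCHyp) (hE : E1NCEntryPerpetual)
    (hO : E1TopSFrozenOffNC) : E 1 :=
  e_one_of_nc hSC h5 e1NC_holds hH hE hO

end Carve

end Summit.ResolutionOfSingularities.ResolutionOfSingularities.Theorems.DeltaCutClasses
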